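import Literature.Topology.FourManifolds.TautFoliationsConePosition
import HarnessLib

/-!
# Checkerboard apex heights for a cone position

Topic: sequel to `TautFoliationsConePosition.lean`. For a cone position `P` of a square with
respect to a transversely oriented foliation, the boundary height of the square `Q`,
`ψ_Q = h_{e_Q} ∘ skel`, is continuous on `∂Q` with values in the open height interval of radius
`ρ / 2` of the sub-box of `Q`; so for ANY prescription of which squares get a roof apex
(`ψ_Q < m_Q`) and which a floor apex (`m_Q < ψ_Q`) — in particular for the checkerboard
prescription — there are **admissible apex heights realising it**:

* `ConePosition.bdryHt P q` (**definition**): `ψ_Q = height (box q) ∘ skel`;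
  `continuousOn_bdryHt`, `bdryHt_mem_ball` (**proved**);
* `ConePosition.exists_apex` (**proved**): for every `roof : squares → Prop` there is an
  admissible `m` with `ψ_Q < m_Q` on `∂Q` when `roof Q` and `m_Q < ψ_Q` on `∂Q` otherwise.

All statements are [folklore].
-/

noncomputable section

open Set Filter Metric Topology

namespace Literature.Topology.FourManifolds

namespace Foliation

variable {B : Type*} [NormedAddCommGroup B] [NormedSpace ℝ B] {M : Type*} [TopologicalSpace M]
  {F : Foliation B M} {f : ℝ × ℝ → M} {c₀ : ℝ × ℝ} {L : ℝ} {hL : 0 < L}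

namespace ConePosition

variable (P : ConePosition F f c₀ hL)

/-- **The boundary height of the square `q`**: the `e_Q`-height of the skeleton map.
[folklore] -/
def bdryHt (q : Fin P.n × Fin P.n) (y : ℝ × ℝ) : ℝ := height (P.box q) (P.skel y)

omit [NormedSpace ℝ B] in
/-- The boundary height is `height (box q) ∘ skel`. [folklore] -/
theorem bdryHt_apply (q : Fin P.n × Fin P.n) (y : ℝ × ℝ) : P.bdryHt q y = height (P.box q) (P.skel y) := rfl

omit [NormedSpace ℝ B] in
/-- **The boundary height is continuous on the boundary of the square.** [folklore] -/
theorem continuousOn_bdryHt (q : Fin P.n × Fin P.n) : ContinuousOn (P.bdryHt q) (sphere (P.gr.centre q) P.gr.ℓ) := by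
  intro y hy
  have h1 : ContinuousWithinAt P.skel (sphere (P.gr.centre q) P.gr.ℓ) y := P.skel_continuousOn q y hy
  exact (continuousAt_height (P.skel_mem_source hy)).comp_continuousWithinAt h1

omit [NormedSpace ℝ B] in
/-- **The boundary heights lie in the height interval of radius `ρ / 2` of the sub-box.**
[folklore] -/
theorem bdryHt_mem_ball {q : Fin P.n × Fin P.n} {y : ℝ × ℝ} (hy : y ∈ sphere (P.gr.centre q) P.gr.ℓ) :
    P.bdryHt q y ∈ ball (P.ctr q).2 (P.ρ / 2) :=
  F.height_mem_ball_of_mem_subbox (P.box_mem q) (P.skel_mem_of_mem_sphere hy)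

omit [NormedSpace ℝ B] in
/-- **Admissible apex heights with prescribed roof/floor pattern exist.** [folklore] -/
theorem exists_apex (roof : Fin P.n × Fin P.n → Prop) :
    ∃ m : Fin P.n × Fin P.n → ℝ, P.AdmissibleApex m ∧
      (∀ q, roof q → ∀ y ∈ sphere (P.gr.centre q) P.gr.ℓ, P.bdryHt q y < m q) ∧
      (∀ q, ¬ roof q → ∀ y ∈ sphere (P.gr.centre q) P.gr.ℓ, m q < P.bdryHt q y) := by
  classical
  have hρ := P.hρ
  -- per square: the range of the boundary height is a compact subset of the open interval
  have key : ∀ q, ∃ lo hi : ℝ, (P.ctr q).2 - P.ρ / 2 < lo ∧ hi < (P.ctr q).2 + P.ρ / 2 ∧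
      ∀ y ∈ sphere (P.gr.centre q) P.gr.ℓ, P.bdryHt q y ∈ Icc lo hi := by
    intro q
    have hcpt : IsCompact (P.bdryHt q '' sphere (P.gr.centre q) P.gr.ℓ) :=
      (isCompact_sphere _ _).image_of_continuousOn (P.continuousOn_bdryHt q)
    have hne : (sphere (P.gr.centre q) P.gr.ℓ).Nonempty := (NormedSpace.sphere_nonempty).2 P.gr.hℓ.le
    obtain ⟨y₁, hy₁, hmin⟩ := (isCompact_sphere _ _).exists_isMinOn hne (P.continuousOn_bdryHt q)
    obtain ⟨y₂, hy₂, hmax⟩ := (isCompact_sphere _ _).exists_isMaxOn hne (P.continuousOn_bdryHt q)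
    refine ⟨P.bdryHt q y₁, P.bdryHt q y₂, ?_, ?_, fun y hy ↦ ⟨hmin hy, hmax hy⟩⟩
    · have := P.bdryHt_mem_ball hy₁
      rw [mem_ball, Real.dist_eq, abs_lt] at this; linarith [this.1]
    · have := P.bdryHt_mem_ball hy₂
      rw [mem_ball, Real.dist_eq, abs_lt] at this; linarith [this.2]
  choose lo hi hlo hhi hmem using key
  refine ⟨fun q ↦ if roof q then (hi q + ((P.ctr q).2 + P.ρ / 2)) / 2 else (lo q + ((P.ctr q).2 - P.ρ / 2)) / 2,
    fun q ↦ ?_, fun q hq y hy ↦ ?_, fun q hq y hy ↦ ?_⟩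
  · -- admissibility
    show |(if roof q then (hi q + ((P.ctr q).2 + P.ρ / 2)) / 2 else (lo q + ((P.ctr q).2 - P.ρ / 2)) / 2) - (P.ctr q).2| < P.ρ / 2
    have hne : (sphere (P.gr.centre q) P.gr.ℓ).Nonempty := (NormedSpace.sphere_nonempty).2 P.gr.hℓ.le
    obtain ⟨y, hy⟩ := hne
    have h1 := hmem q y hy
    have hlohi : lo q ≤ hi q := h1.1.trans h1.2
    split_ifs with h
    · rw [abs_lt]; constructor <;> linarith [hlo q, hhi q]
    · rw [abs_lt]; constructor <;> linarith [hlo q, hhi q]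
  · simp only [if_pos hq]
    linarith [(hmem q y hy).2, hhi q]
  · simp only [if_neg hq]
    linarith [(hmem q y hy).1, hlo q]

end ConePosition

end Foliation

end Literature.Topology.FourManifolds
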